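import Summits.RiemannHypothesis.RiemannHypothesis.Theorems.TiltedLandingLaw421R3NewtonDoor1

/-!
# W-08 · C1 (rh-idea-5 g34) — K-1: the LOCATED Newton door (`RhW08.PerturbativeRung.SecondOrderNewtonDoorQ` of lens-2 `RungP-v1.lean` 86910840, (CA624)(C))

SUPPORT only (image candidate `…/Theorems/TiltedLandingLaw421R3NewtonDoorLocated.lean`, `--supports stmt-RiemannHypothesis-33346 --as helper`):
proves no stub, no crux, no `sorry`; no law is typed.  Tree imports only (`…R3NewtonDoor1`, whence `…R3ClusterQM`).

The tree's Newton door `RhW08.NewtonDoor.succ_of_newton_door` runs the Rouché comparison of `F′ = h + (· − v)·h′` against the LINEAR MODEL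
`(1 + K(· − v))·h` on the Newton circle `‖z − (v − K⁻¹)‖ = ρ₀/‖K‖` and then EXPORTS only a level-`(j+1)` band state.  The comparison itself is the
tree lemma `RhW08.ClusterQM.exists_deriv_zero_of_model_zero` ((B4): model zero ⇒ critical point INSIDE the disc), which already carries the
LOCATION.  This file re-exports that location with the door's own hypotheses, frame-free:

★ `located_newton_door` (domination form): `F`, `h` entire, `F = (· − v)·h`, `K ≠ 0`, `0 < ρ₀`, `h` zero-free on the CLOSED Newton disc, the
field-variation domination `‖z − v‖·‖h′(z) − K·h(z)‖ < ρ₀·‖h(z)‖` on the Newton circle ⇒ `∃ u, ‖u − (v − K⁻¹)‖ < ρ₀/‖K‖ ∧ F′ u = 0 ∧ h u ≠ 0`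
(a MOVING child inside the disc).  Proof = `deriv_factor` + `defect_eq` + `norm_linModel_circle` + `linModel_newton` + `linModel_ne_zero` (all
`RhW08.NewtonDoor`, tree) feeding `exists_deriv_zero_of_model_zero`; `h u ≠ 0` is the zero-freeness hypothesis at the point found.
★★ `located_newton_door_lip` (Lipschitz form — LITERALLY the binder list of `RhW08.PerturbativeRung.SecondOrderNewtonDoorQ`): the domination
replaced by `‖h′/h(z) − K‖ ≤ Λ` on the Newton circle with `(1 + ρ₀)·Λ < ρ₀·‖K‖`, via the tree's `RhW08.NewtonDoor.fieldVariation_of_lipschitz`.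
Hence `theorem secondOrderNewtonDoorQ_holds : SecondOrderNewtonDoorQ := located_newton_door_lip` in lens-2's namespace (one line, by name; shown in the
C1 compose twin, not here — this file types nothing of lens-2's).  «Second order» is the caller's choice `ρ₀ = C₀/λ²`; nothing in the lemma depends on it.
Nothing here bears on the truth of RH; RH is NOT proved; RUNG-P is a candidate, not a theorem; 33346 / 33347 OPEN; checked ≠ landed ≠ proved.
-/

namespace RhW08.NewtonDoor

open Complex
open RhW08.ClusterQM

/-- ★ THE LOCATED NEWTON DOOR (domination form): `F = (· − v)·h` with `F`, `h` entire, `K ≠ 0`, `0 < ρ₀`, `h` zero-free on the closed Newton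
disc `‖z − (v − K⁻¹)‖ ≤ ρ₀/‖K‖`, and the field-variation domination `‖z − v‖·‖h′ z − K·h z‖ < ρ₀·‖h z‖` on the Newton circle ⇒ a zero `u` of
`F′` with `h u ≠ 0` STRICTLY INSIDE the Newton disc.  (Rouché against the linear model `1 + K(z − v)`, whose only zero is the Newton point
`v − K⁻¹`; the comparison is the tree's `RhW08.ClusterQM.exists_deriv_zero_of_model_zero`.) -/
theorem located_newton_door {F h : ℂ → ℂ} {v K : ℂ} {ρ₀ : ℝ} (hF : Differentiable ℂ F) (hh : Differentiable ℂ h)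
    (hfac : ∀ u : ℂ, F u = (u - v) * h u) (hK : K ≠ 0) (hρ₀ : 0 < ρ₀)
    (hh0 : ∀ u : ℂ, ‖u - (v - K⁻¹)‖ ≤ ρ₀ / ‖K‖ → h u ≠ 0)
    (hvar : ∀ u : ℂ, ‖u - (v - K⁻¹)‖ = ρ₀ / ‖K‖ → ‖u - v‖ * ‖deriv h u - K * h u‖ < ρ₀ * ‖h u‖) :
    ∃ u : ℂ, ‖u - (v - K⁻¹)‖ < ρ₀ / ‖K‖ ∧ deriv F u = 0 ∧ h u ≠ 0 := by
  have hρ : 0 < ρ₀ / ‖K‖ := div_pos hρ₀ (norm_pos_iff.mpr hK)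
  have hM : Differentiable ℂ (fun z : ℂ => 1 + K * (z - v)) := by fun_prop
  have hFeq : F = fun y : ℂ => (y - v) * h y := funext hfac
  have hdF : ∀ z : ℂ, deriv F z = h z + (z - v) * deriv h z := by
    intro z
    rw [hFeq]
    exact deriv_factor hh v z
  have hdom : ∀ z : ℂ, ‖z - (v - K⁻¹)‖ = ρ₀ / ‖K‖ →
      ‖deriv F z - (1 + K * (z - v)) * h z‖ < ‖(1 + K * (z - v)) * h z‖ := by
    intro z hz
    rw [hdF z, defect_eq h K v z, norm_mul, norm_mul, norm_linModel_circle hK hz]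
    exact hvar z hz
  have hMz : ∃ z₀ : ℂ, ‖z₀ - (v - K⁻¹)‖ < ρ₀ / ‖K‖ ∧ 1 + K * (z₀ - v) = 0 :=
    ⟨v - K⁻¹, by simpa using hρ, linModel_newton hK v⟩
  obtain ⟨u, hu, hdu⟩ := exists_deriv_zero_of_model_zero hρ hF hh hM (linModel_ne_zero K v) hh0 hdom hMz
  exact ⟨u, hu, hdu, hh0 u hu.le⟩

/-- ★★ THE LOCATED NEWTON DOOR, LIPSCHITZ FORM (binders = `RhW08.PerturbativeRung.SecondOrderNewtonDoorQ` verbatim): on the Newton circle the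
cofactor field `h′/h` stays within `Λ` of `K` and `(1 + ρ₀)·Λ < ρ₀·‖K‖` ⇒ a zero `u` of `F′` with `h u ≠ 0` strictly inside the Newton disc.
(`fieldVariation_of_lipschitz` turns the Lipschitz bound into the domination of `located_newton_door`.) -/
theorem located_newton_door_lip (F h : ℂ → ℂ) (v K : ℂ) (ρ₀ Λ : ℝ) (hF : Differentiable ℂ F) (hh : Differentiable ℂ h)
    (hfac : ∀ u : ℂ, F u = (u - v) * h u) (hK : K ≠ 0) (hρ₀ : 0 < ρ₀) (hΛ : (1 + ρ₀) * Λ < ρ₀ * ‖K‖)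
    (hh0 : ∀ u : ℂ, ‖u - (v - K⁻¹)‖ ≤ ρ₀ / ‖K‖ → h u ≠ 0)
    (hlip : ∀ u : ℂ, ‖u - (v - K⁻¹)‖ = ρ₀ / ‖K‖ → ‖deriv h u / h u - K‖ ≤ Λ) :
    ∃ u : ℂ, ‖u - (v - K⁻¹)‖ < ρ₀ / ‖K‖ ∧ deriv F u = 0 ∧ h u ≠ 0 :=
  located_newton_door hF hh hfac hK hρ₀ hh0 (fieldVariation_of_lipschitz hK hΛ hh0 hlip)

/-- The located door in the exact `∀`-shape of lens-2's `SecondOrderNewtonDoorQ` (the Prop spelled out; by `located_newton_door_lip`). -/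
theorem located_newton_door_forall :
    ∀ (F h : ℂ → ℂ) (v K : ℂ) (ρ₀ Λ : ℝ), Differentiable ℂ F → Differentiable ℂ h → (∀ u : ℂ, F u = (u - v) * h u) → K ≠ 0 → 0 < ρ₀ →
      (1 + ρ₀) * Λ < ρ₀ * ‖K‖ →
      (∀ u : ℂ, ‖u - (v - K⁻¹)‖ ≤ ρ₀ / ‖K‖ → h u ≠ 0) →
      (∀ u : ℂ, ‖u - (v - K⁻¹)‖ = ρ₀ / ‖K‖ → ‖deriv h u / h u - K‖ ≤ Λ) →
      ∃ u : ℂ, ‖u - (v - K⁻¹)‖ < ρ₀ / ‖K‖ ∧ deriv F u = 0 ∧ h u ≠ 0 :=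
  located_newton_door_lip

end RhW08.NewtonDoor
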